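import Summits.HodgeConjecture.HodgeConjecture.Theorems.P2StubU2OfLettersFinal
import Summits.HodgeConjecture.HodgeConjecture.Theorems.H413SpectrumInterfacesKernel
import Literature.NumberTheory.Automorphic.UnitaryGroupCotangentSpectralProjectionConj
import HarnessLib

/-!
# Crux `H413`, programme P2 (cut `F0_P2CohSpectrumL2`) — the ENGINE SOCKET E2E2b IS WEAKER THAN THE PARENT STUB U2′: `StubE2E2bCotPartSpectrumIsTheta` from
# `StubU2CohFormsSpectrumIsThetaAt`, hence from the letters {(C), (C′), (D)}

Cell hodgecm-mathlib (D-0151), FLOOR 0, crux item H413 = stmt-HodgeConjecture-24833; programme P2, cut line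
`Cruxes/H413/Lines/F0_P2CohSpectrumL2.lean` v1.3 (6761f578; stubs U2ℓ ★, U2a ★-fold, **E2E2b open**).  Author F0P2-p01 (g2).  THEOREMS ONLY (no definition, no
instance, no named fact, no `sorry`); `--supports stmt-HodgeConjecture-24833 --as helper`.  HC_CM is proved only modulo the 7 printed citations until rung 0
closes; this file proves nothing about them.

`SpectrumIsThetaAtLevel P R A` («every irreducible occurring in `A` is Hecke-related to a genuine `ω_t`») is ANTITONE in `A` (occurring in a smaller space is occurring
in the larger), and `cotPart 𝔞₀ μ ℓ Π ≤ cohForms 𝔞₀` (★ `cotPart_le_cohForms`); so the cut's engine socket E2E2b (the spectrum of the cotangent part of EACH discrete `Π` is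
theta) follows from the parent stub U2′ (the spectrum of ALL cotangent forms is theta) — as ★ (A)'s own docstring of `StubE2E2bCotPartSpectrumIsTheta` says («STRICTLY WEAKER
than the parent U2′»).  With ★ `P2StubU2OfLettersFinal` (p793962) the socket closes modulo the SAME letters as the parent: {(C) `cohFinComponent_isTheta`, (C′)
`rhoAtLine_lineClassTransport`, (D) `holCotFormSpectralProjection` (+ (D̄), which is (D) by ★ `antiholCotFormSpectralProjection_of_hol`, p794879)}.

* `occursIn_mono`, `spectrumIsThetaAtLevel_anti` — monotonicity in the subspace `A`;
* `stubE2E2b_of_stubU2 : StubU2CohFormsSpectrumIsThetaAt → StubE2E2bCotPartSpectrumIsTheta`;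
* `stubE2E2b_of_letters (hC) (hC′) (hD) (hD′)`, `stubE2E2b_of_letters' (hC) (hC′) (hD)` — the registrar's fold for the cut (v1.4: `stub_E2E2b_cotPartSpectrumIsTheta :=
  P2StubE2E2bOfU2.stubE2E2b_of_letters stub_C stub_C′ stub_D stub_D̄`, sockets shared with the parent).

## References
* [Liu2021] Y. Liu, Camb. J. Math. 9 (2021) = arXiv:2102.11518: proof of Prop. 4.13 (l. 2131–2146), Rem. 4.14.
* [GelbartRogawski1991] Invent. Math. 105 (1991), Introduction p. 448 L30–33; Thm. 5.1.1; Lem. 5.1.2.  [Rogawski1990] Thm. 13.3.6 (c), §14.6, §15.3.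
* [BorelJacquet1979] §4.6.  [GelfandGraevPiatetskiShapiro1969] Ch. 1 §2.
-/

set_option autoImplicit false

-- the mandated namespace has the single-problem summit's repeated segment (`HodgeConjecture.HodgeConjecture`)
set_option linter.dupNamespace false

noncomputable section

namespace Summit.HodgeConjecture.HodgeConjecture.Cruxes.H413.P2StubE2E2bOfU2

open NumberField
open Literature.NumberTheory.Automorphic.UnitaryGroup.CotangentForms (holCotFormSpectralProjection antiholCotFormSpectralProjection
  antiholCotFormSpectralProjection_of_hol)
open Literature.NumberTheory.Automorphic.Liu2021 (Prop413Data)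
open Summit.HodgeConjecture.HodgeConjecture.Cruxes.H413.CohFormsCarriers
open Summit.HodgeConjecture.HodgeConjecture.Cruxes.H413.SpectrumInterfaces

/-! ## §1 Monotonicity of `OccursIn` ∕ antitonicity of `SpectrumIsThetaAtLevel` in the subspace -/

section Generic

variable {F₀ E₀ : Type} [Field F₀] [NumberField F₀] [IsTotallyReal F₀] [Field E₀] [NumberField E₀] [Algebra F₀ E₀]
  [IsTotallyComplex E₀] [Algebra.IsQuadraticExtension F₀ E₀]

/-- `OccursIn` is MONOTONE in the subspace: a representation occurring in `A′ ≤ A` occurs in `A`. [cite: BorelJacquet1979, §4.6] -/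
theorem occursIn_mono (P : Prop413Data F₀ E₀) {X : Type} [AddCommGroup X] [Module ℂ X] (R : Representation ℂ P.G X)
    {A A' : Submodule ℂ X} (hle : A' ≤ A) {W : Type} [AddCommGroup W] [Module ℂ W] {σ : Representation ℂ P.G W}
    (h : OccursIn P R A' σ) : OccursIn P R A σ := by
  obtain ⟨θ, hθ0, hθA, hθσ⟩ := h
  exact ⟨θ, hθ0, fun w => hle (hθA w), hθσ⟩

/-- `SpectrumIsThetaAtLevel` is ANTITONE in the subspace: if the spectrum of `A` is theta at finite level, so is the spectrum of every `A′ ≤ A`.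
[cite: Liu2021, proof of Prop. 4.13, l. 2131] [cite: BorelJacquet1979, §4.6] -/
theorem spectrumIsThetaAtLevel_anti (P : Prop413Data F₀ E₀) {X : Type} [AddCommGroup X] [Module ℂ X] (R : Representation ℂ P.G X)
    {A A' : Submodule ℂ X} (hle : A' ≤ A) (h : SpectrumIsThetaAtLevel P R A) : SpectrumIsThetaAtLevel P R A' :=
  fun hn W _ _ σ hirr hocc => h hn W σ hirr (occursIn_mono P R hle hocc)

end Generic

/-! ## §2 E2E2b from U2′, and from the letters -/

set_option synthInstance.maxHeartbeats 400000 in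
set_option maxHeartbeats 8000000 in
/-- **E2E2b ⇐ U2′**: the cotangent part of every discrete `Π` sits inside `cohForms 𝔞₀` (★ `cotPart_le_cohForms`), and `SpectrumIsThetaAtLevel` is antitone.
[cite: Liu2021, proof of Prop. 4.13, l. 2131–2146; Rem. 4.14] [cite: GelbartRogawski1991, Introduction p. 448 L30–33; Thm 5.1.1 p. 465] -/
theorem stubE2E2b_of_stubU2 (h2 : StubU2CohFormsSpectrumIsThetaAt) : StubE2E2bCotPartSpectrumIsTheta :=
  fun hDel F _ h6 _ V a₀ Φ hΦ i μ _ ℓ _ π =>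
    spectrumIsThetaAtLevel_anti (Summit.HodgeConjecture.CorCM.Lines.A3Liu413.datum413 hDel F V a₀ Φ i) (rightRep F V)
      (cotPart_le_cohForms F V (archFactorOf F V) μ ℓ π) (h2 hDel F h6 V a₀ Φ hΦ i)

set_option synthInstance.maxHeartbeats 400000 in
set_option maxHeartbeats 8000000 in
/-- **E2E2b from the letters {(C), (C′), (D), (D̄)}** — U2′ := ★ `P2StubU2OfLettersFinal.stub_U2_cohFormsSpectrumIsThetaAt_of_letters` (p793962).  The registrar's fold for the cut line:
`stub_E2E2b_cotPartSpectrumIsTheta := P2StubE2E2bOfU2.stubE2E2b_of_letters stub_C… stub_Cprime… stub_D… stub_D…`. [cite: Rogawski1990, Thm. 13.3.6 (c); §14.6; §15.3]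
[cite: GelbartRogawski1991, Thm 5.1.1 p. 465; Lemma 5.1.2 p. 466] [cite: Liu2021, Rem. 4.14; App. D Lem. D.1] -/
theorem stubE2E2b_of_letters (hC : Literature.NumberTheory.Rogawski1990.cohFinComponent_isTheta)
    (hC' : Literature.NumberTheory.Automorphic.Liu2021.Def411WeilCarriers.rhoAtLine_lineClassTransport)
    (hD : holCotFormSpectralProjection) (hD' : antiholCotFormSpectralProjection) : StubE2E2bCotPartSpectrumIsTheta :=
  stubE2E2b_of_stubU2 (P2StubU2OfLettersFinal.stub_U2_cohFormsSpectrumIsThetaAt_of_letters hC hC' hD hD')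

set_option synthInstance.maxHeartbeats 400000 in
set_option maxHeartbeats 8000000 in
/-- **E2E2b from {(C), (C′), (D)}** — (D̄) is (D) (★ `antiholCotFormSpectralProjection_of_hol`). [cite: Rogawski1990, Thm. 13.3.6 (c); §14.6; §15.3]
[cite: GelbartRogawski1991, Thm 5.1.1 p. 465] [cite: BorelWallach2000, VII 2.10] -/
theorem stubE2E2b_of_letters' (hC : Literature.NumberTheory.Rogawski1990.cohFinComponent_isTheta)
    (hC' : Literature.NumberTheory.Automorphic.Liu2021.Def411WeilCarriers.rhoAtLine_lineClassTransport)
    (hD : holCotFormSpectralProjection) : StubE2E2bCotPartSpectrumIsTheta :=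
  stubE2E2b_of_letters hC hC' hD (antiholCotFormSpectralProjection_of_hol hD)

end Summit.HodgeConjecture.HodgeConjecture.Cruxes.H413.P2StubE2E2bOfU2

end
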